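import Literature.MathematicalPhysics.QuantumFieldTheory.Balaban1983to89.B9Letters313AtOneDv
import Literature.MathematicalPhysics.QuantumFieldTheory.Balaban1983to89.B9SectDL2Decay

/-!
# `Balaban1983to89.B9Prop26L2AtPinsOne` — [4] Prop. 2.6 (2.140) p. 247 (N03's theorem of record) AS BLOCK-L² BOUNDS ON THE TORUS, uniformly on
# the k-level census (the `L²` twin of dag-n06-h's `B9Prop26AtPinsOne` §1) — the input of the `U = 1` inhabitants of the N06 certificate's `hLL2`

T. Bałaban, *Propagators for lattice gauge theories in a background field*, Commun. Math. Phys. **99** (1985) 389–434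
[`Balaban1985BackgroundPropagators`, "B9"]; [4] = T. Bałaban, *Propagators and renormalization transformations for lattice gauge
theories. II*, Commun. Math. Phys. **96** (1984) 223–250 [`Balaban1984PropagatorsII`].

statement-level skeleton of published theorems with citation tags; proofs where landed; nothing here is a claim about the Yang–Mills mass gap

THE PRINTED LOCI (verbatim).  [4] Prop. 2.6 p. 247: *"‖ζGJ‖, ‖ζ∇GJ‖, ‖ζG∇\*J‖, ‖ζ∇G∇\*J‖, ‖ζ∇∇GJ‖, ‖ζG∇\*∇\*J‖ ≤ O(1)[(L^jη)², L^jη, L^jη, 1, 1, 1]|ζ|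
e^{−δ₃d(y,y′)}‖J‖ (2.140) if supp ζ ⊂ Δ(y), y ∈ Λ_j, supp J ⊂ Δ(y′)"*; (2.51)–(2.54) pp. 232–233 (block majorants, block `L²` norms); Lemma 2.1 (2.61)
p. 234.  [B9] (3.46) p. 398 (the `L²` members of Thm 3.3), Cor. 3.5 p. 407: *"for U = 1 these theorems are proved in [4]"*.

THE POINT.  dag-n06-d's N06 certificate (edition 22 `Summits/…/BalabanUVNodesN06AtOpsYNuOfRecordV6EPairNC`) displays `hLL2 : … → Letters313L2PZ (𝔬12 x) …
∧ Letters313L2MZ …` (dag-n06-l's block-L² letters of Thm 3.13's reduction, `B9SectDL2Decay.BlockBd` between r1's block-L² sizes `bl2`).  No `U = 1`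
inhabitant of any of its fields was on record.  THIS FILE: ★★ `blockBd_Gop_kIdx` — ALL SIX (2.140) slots of N03's hypothesis-free
`B6Prop26PrintedKLevelFinalV1.prop26Printed_kLevel` (fifth conjunct) as `BlockBd` statements for r03's `Gop i = Δ_a⁻¹`, `∇_νGop`, `Gop∇*_ν`, `∇_νGop∇*_μ`,
`∇_ν∇_μGop`, `Gop∇*_ν∇*_μ` w.r.t. the fine-bond block map `blkV1`, at the indicator cuts `h = 1_{Δ(y)}` (`cutIn` ✓, `cutSup ≤ 1`, `l2Of 1_{Δ(y)} = bl2`,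
`l2Norm = bl2` on block-supported inputs).  The re-blocking onto the certificate's index-bond block map is the sibling `B9BlockL2ReblockEngine`;
the sequel `B9Letters313AtOneL2` feeds it the two sources (`Q*♭`, `∂♭`) and dag-n06-d's
coordinate functor.

HONEST SCOPE.  A READING file: the analytic input is N03's Prop. 2.6 (2.140) and p21's Lemma 2.1, tree theorems cited by name; block-L² bookkeeping over
r1's `bsq ∕ bl2 ∕ BlockBd`; nothing of [B9] at curved `U` is asserted.  COUNT-NEUTRAL; N06 is NOT discharged; one finite lattice at a time; nothing continuum,
nothing about the mass gap.  Cell `pub-ymgap` (HUMAN RULING D-0062 ∕ D-0149), Track A node N06 [B9], rows 20–21 JSAT lane, width seat `pub-ymgap-dag-n06-w3`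
(g2), 2026-08-28.
-/

noncomputable section

namespace Literature.MathematicalPhysics.QuantumFieldTheory.Balaban1983to89.B9Prop26L2AtPinsOne

open B6MultiLevelTorusOperator (TDomains) open B6Geom246MultiLevelTorus (geomT) open B6GlobalChartV1 (PV blkV1 boxEquiv toBox)
open B6KLevelCensusIndexV1 (KIdx kGeo kGeoG) open B6Prop26Census2136KLevelV1 (Gop supIn kG l2Of) open B6RandomWalk (HasMajorant BlockSupp blockPiece sum_blockPiece)
open B6RandomWalkHom (HasMajorantHom) open B6GradLegKLevelV1 (DV) open B6LapLegKLevelV1 (DVa DVa_apply LapV) open B6 (pref6)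
open B6Ineq2142KLevelV1 (lvl β) open B6Ineq288MultiLevelTorus (dist_symm_geoBT) open B9Thm314GpFlatMultiLevelTorus (consts_260_261)
open B6Lemma21Repaired (Ineq261With) open B9GeoNormsKLevelV1 (geo9K) open B9GeoLemma21KLevelV1 (one_le_Mh geo9K_len_pos geo9K_dist_comm geo9K_M_nonneg)
open B9Ineq349SiteComposite (distB distB_nonneg) open B9Ineq349SiteFromBlocks (distB_triangle) open B9Thm39ReadingCoords (cR39 cR39_nonneg)
open B9CoReadingCoords B9CoReadingCoordsH open B9CoReadingCoordsS (XSK blkSK sIK blkV1_site) open B9Thm34Ext (toB6) open B9SectDL2Decay (bsq bl2 BlockBd)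
open B9PinCarriersNonVacuity (l2Of_nonneg) open Node00 Node00.OpsYSectDCoords
open scoped Matrix

variable {d ℓ : ℕ} {hd : 1 ≤ d + 1} {hL : Odd (ℓ + 1) ∧ 1 < ℓ + 1} {b₀ b₁ : ℝ}

/-! ## §1 (2.140) for `Gop = Δ_a⁻¹` as block-L² bounds w.r.t. the fine-bond block map, every k-level index above one threshold -/

section Census

variable (i : KIdx d ℓ hd hL b₀ b₁)

/-- the indicator of the torus block `y` on the fine bonds (the cut `h = 1_{Δ(y)}` of (2.140)). [cite: Balaban1984PropagatorsII, (2.140) p.247 («supp ζ ⊂ Δ(y)»), dictionary] -/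
theorem l2Of_indicator_eq_bl2 (y : (geomT i.D).Site) (F : FBondY i → ℝ) :
    l2Of (fun f : FBondY i => if blkV1 i.hN i.D f = y then (1 : ℝ) else 0) F = bl2 (g := geomT i.D) (blkV1 i.hN i.D) y F := by
  classical
  unfold l2Of bl2 bsq
  congr 1
  refine Finset.sum_congr rfl fun f _ => ?_
  by_cases h : blkV1 i.hN i.D f = y
  · simp [h]
  · simp [h]
    exact fun h' => absurd h' h

/-- the indicator cut is admissible at `y` (`cutIn`) and has `cutSup ≤ 1`. [cite: Balaban1984PropagatorsII, (2.140) p.247, bookkeeping] -/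
theorem cutIn_indicator (y : (geomT i.D).Site) :
    (kGeoG i).cutIn (fun f : FBondY i => if blkV1 i.hN i.D f = y then (1 : ℝ) else 0) y := by
  intro f hf
  have hfy : blkV1 i.hN i.D f = y := by by_contra h; simp only [h, if_false, ne_eq, not_true_eq_false] at hf
  show (((B6Geom246MultiLevelTorus.bondT i.D).dist (blkV1 i.hN i.D f) y : ℕ) : ℝ) ≤ 1
  rw [hfy, SimpleGraph.dist_self]; norm_num

/-- `cutSup (1_{Δ(y)}) ≤ 1`. [cite: Balaban1984PropagatorsII, (2.140) p.247, bookkeeping] -/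
theorem cutSup_indicator_le (y : (geomT i.D).Site) :
    (kGeoG i).cutSup (fun f : FBondY i => if blkV1 i.hN i.D f = y then (1 : ℝ) else 0) ≤ 1 := by
  refine Real.iSup_le (fun f => ?_) zero_le_one
  by_cases h : blkV1 i.hN i.D f = y
  · simp only [h, if_true, abs_one, le_refl]
  · simp only [h, if_false, abs_zero, zero_le_one]

/-- the census `l2Norm` of a block-supported function is its block-L² size. [cite: Balaban1984PropagatorsII, (2.140) p.247 («‖J‖», supp J ⊂ Δ(y′)), bookkeeping] -/
theorem l2Norm_eq_bl2_of_supp {J : FBondY i → ℝ} {y' : (geomT i.D).Site} (hJ : ∀ x, blkV1 i.hN i.D x ≠ y' → J x = 0) :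
    (kGeoG i).l2Norm J = bl2 (g := geomT i.D) (blkV1 i.hN i.D) y' J := by
  classical
  show Real.sqrt (∑ x, J x ^ 2) = Real.sqrt (bsq (g := geomT i.D) (blkV1 i.hN i.D) y' J)
  congr 1
  rw [← B9SectDL2Decay.sum_bsq (g := geomT i.D) (blkV1 i.hN i.D) J, Finset.sum_eq_single y']
  · intro y _ hy; exact B9SectDL2Decay.bsq_eq_zero_of_loc (g := geomT i.D) (blkV1 i.hN i.D) hy J hJ
  · intro h; exact absurd (Finset.mem_univ _) h

/-- ★ **(2.140) IN CENSUS FORM ⇒ A BLOCK-L² BOUND IN THE ENGINE'S SHAPE**: if slot `n` of r03's census reading `kG … .l2` dominates the block-L² size of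
`T·` at the indicator cut and obeys the (2.140)-shaped bound with prefactor `pref6 (L^{j}η) n = (L^{j}η)^m`, then `T` has the block bound
`(C′η^m)·L^{mj(y)}·e^{−δ₃d_T(y,y′)}` between the fine-bond block-L² sizes. [cite: Balaban1984PropagatorsII, Prop. 2.6 (2.140) p.247 + (2.51)–(2.54) pp.232–233] -/
theorem blockBd_of_census2140 {T : Module.End ℝ (FBondY i → ℝ)} (n : Fin 6) (m : ℕ) {C' δ₃ : ℝ} (hC' : 0 ≤ C')
    (h2140 : ∀ (J h : FBondY i → ℝ) (y y' : (geomT i.D).Site), (kGeoG i).cutIn h y → (kGeoG i).suppIn J y' →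
      (kG i).l2 n J h ≤ C' * pref6 ((kGeoG i).len y) n * (kGeoG i).cutSup h * Real.exp (-(δ₃ * (kGeoG i).dist y y')) * (kGeoG i).l2Norm J)
    (hpref : ∀ t : ℝ, pref6 t n = t ^ m)
    (hT : ∀ (J : FBondY i → ℝ) (y : (geomT i.D).Site),
      bl2 (g := geomT i.D) (blkV1 i.hN i.D) y (T J) ≤ (kG i).l2 n J (fun f : FBondY i => if blkV1 i.hN i.D f = y then (1 : ℝ) else 0)) :
    BlockBd (g := geomT i.D) (blkV1 i.hN i.D) (blkV1 i.hN i.D) T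
      (fun y y' => C' * |i.cf|⁻¹ ^ m * ((ℓ : ℝ) + 1) ^ (m * y.1.1) * Real.exp (-(δ₃ * (geomT i.D).dist y y'))) := by
  intro y' J hJ y
  have hlen : (kGeoG i).len y = (((ℓ + 1 : ℕ) : ℝ)) ^ y.1.1 * |i.cf|⁻¹ := rfl
  have hdist : (kGeoG i).dist y y' = (geomT i.D).dist y y' := rfl
  have hsupp : (kGeoG i).suppIn J y' := fun x hx => by by_contra hne; exact hx (hJ x hne)
  have h := h2140 J _ y y' (cutIn_indicator i y) hsupp
  rw [hpref, hlen, hdist, l2Norm_eq_bl2_of_supp i hJ] at h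
  push_cast at h
  have hb0 : 0 ≤ bl2 (g := geomT i.D) (blkV1 i.hN i.D) y' J := B9SectDL2Decay.bl2_nonneg _ _ _
  have hexp0 : 0 ≤ C' * (((ℓ : ℝ) + 1) ^ y.1.1 * |i.cf|⁻¹) ^ m := by positivity
  calc bl2 (g := geomT i.D) (blkV1 i.hN i.D) y (T J) ≤ _ := hT J y
    _ ≤ C' * (((ℓ : ℝ) + 1) ^ y.1.1 * |i.cf|⁻¹) ^ m * (kGeoG i).cutSup (fun f : FBondY i => if blkV1 i.hN i.D f = y then (1 : ℝ) else 0) *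
        Real.exp (-(δ₃ * (geomT i.D).dist y y')) * bl2 (g := geomT i.D) (blkV1 i.hN i.D) y' J := h
    _ ≤ C' * (((ℓ : ℝ) + 1) ^ y.1.1 * |i.cf|⁻¹) ^ m * 1 * Real.exp (-(δ₃ * (geomT i.D).dist y y')) * bl2 (g := geomT i.D) (blkV1 i.hN i.D) y' J := by
        gcongr
        exact cutSup_indicator_le i y
    _ = C' * |i.cf|⁻¹ ^ m * ((ℓ : ℝ) + 1) ^ (m * y.1.1) * Real.exp (-(δ₃ * (geomT i.D).dist y y')) * bl2 (g := geomT i.D) (blkV1 i.hN i.D) y' J := by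
        rw [mul_pow, ← pow_mul']; ring

/-- ★★ **[4] PROP. 2.6 (2.140) AS BLOCK-L² BOUNDS, UNIFORM ON THE k-LEVEL CENSUS**: for the band `0 < b₀ ≤ b₁` there are `M₁, δ₃, C > 0` such that for
every index `i` with `M ≥ M₁` the genuine `G = Δ_a⁻¹` (r03's `Gop i`) has, between the fine-bond block-L² sizes w.r.t. `blkV1`, the bounds
`‖1_{Δ(y)}GJ‖ ≤ C·η²L^{2j(y)}e^{−δ₃d}‖J‖`, `‖1_{Δ(y)}∇_νGJ‖, ‖1_{Δ(y)}G∇*_νJ‖ ≤ C·ηL^{j(y)}e^{−δ₃d}‖J‖`, `‖1_{Δ(y)}∇_νG∇*_μJ‖, ‖1_{Δ(y)}∇_ν∇_μGJ‖,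
‖1_{Δ(y)}G∇*_ν∇*_μJ‖ ≤ C·e^{−δ₃d}‖J‖` (`supp J ⊂ Δ(y′)`) — N03's theorem of record `prop26Printed_kLevel`, fifth conjunct, at the indicator cuts.
[cite: Balaban1984PropagatorsII, Prop. 2.6 (2.140) p.247 + (2.51)–(2.54) pp.232–233; Balaban1985BackgroundPropagators, (3.46) p.398, Cor. 3.5 p.407] -/
theorem blockBd_Gop_kIdx (hb₀ : 0 < b₀) (hb₁ : b₀ ≤ b₁) : ∃ M₁ δ₃ C : ℝ, 0 < M₁ ∧ 0 < δ₃ ∧ 0 < C ∧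
    ∀ i : KIdx d ℓ hd hL b₀ b₁, M₁ ≤ (kGeoG i).M →
      BlockBd (g := geomT i.D) (blkV1 i.hN i.D) (blkV1 i.hN i.D) (Gop i)
          (fun y y' => C * |i.cf|⁻¹ ^ 2 * ((ℓ : ℝ) + 1) ^ (2 * y.1.1) * Real.exp (-(δ₃ * (geomT i.D).dist y y'))) ∧
      (∀ ν : Fin (d + 1), BlockBd (g := geomT i.D) (blkV1 i.hN i.D) (blkV1 i.hN i.D) (DV ν i.cf ∘ₗ Gop i)
          (fun y y' => C * |i.cf|⁻¹ ^ 1 * ((ℓ : ℝ) + 1) ^ (1 * y.1.1) * Real.exp (-(δ₃ * (geomT i.D).dist y y')))) ∧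
      (∀ ν : Fin (d + 1), BlockBd (g := geomT i.D) (blkV1 i.hN i.D) (blkV1 i.hN i.D) (Gop i ∘ₗ DVa ν i.cf)
          (fun y y' => C * |i.cf|⁻¹ ^ 1 * ((ℓ : ℝ) + 1) ^ (1 * y.1.1) * Real.exp (-(δ₃ * (geomT i.D).dist y y')))) ∧
      (∀ ν μ : Fin (d + 1), BlockBd (g := geomT i.D) (blkV1 i.hN i.D) (blkV1 i.hN i.D) (DV ν i.cf ∘ₗ Gop i ∘ₗ DVa μ i.cf)
          (fun y y' => C * |i.cf|⁻¹ ^ 0 * ((ℓ : ℝ) + 1) ^ (0 * y.1.1) * Real.exp (-(δ₃ * (geomT i.D).dist y y')))) ∧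
      (∀ ν μ : Fin (d + 1), BlockBd (g := geomT i.D) (blkV1 i.hN i.D) (blkV1 i.hN i.D) (DV ν i.cf ∘ₗ DV μ i.cf ∘ₗ Gop i)
          (fun y y' => C * |i.cf|⁻¹ ^ 0 * ((ℓ : ℝ) + 1) ^ (0 * y.1.1) * Real.exp (-(δ₃ * (geomT i.D).dist y y')))) ∧
      (∀ ν μ : Fin (d + 1), BlockBd (g := geomT i.D) (blkV1 i.hN i.D) (blkV1 i.hN i.D) (Gop i ∘ₗ DVa ν i.cf ∘ₗ DVa μ i.cf)
          (fun y y' => C * |i.cf|⁻¹ ^ 0 * ((ℓ : ℝ) + 1) ^ (0 * y.1.1) * Real.exp (-(δ₃ * (geomT i.D).dist y y')))) := by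
  obtain ⟨M₁, δ₃, C', Cα, Cε, Cαε, hM₁, hδ₃, hC', H⟩ :=
    B6Prop26PrintedKLevelFinalV1.prop26Printed_kLevel (d := d) (ℓ := ℓ) (hd := hd) (hL := hL) hb₀ hb₁
  refine ⟨M₁, δ₃, C', hM₁, hδ₃, hC', fun i hM => ?_⟩
  have h2140 := (H i trivial hM).2.2.2.2
  have hfin : ∀ {ι : Type} [Finite ι] [Nonempty ι] (u : ι → ℝ) (k : ι), u k ≤ ⨆ j, u j := fun u k =>
    le_ciSup (Set.finite_range _).bddAbove k
  refine ⟨?_, fun ν => ?_, fun ν => ?_, fun ν μ => ?_, fun ν μ => ?_, fun ν μ => ?_⟩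
  · exact blockBd_of_census2140 i 0 2 hC'.le (h2140 0) (fun t => by simp [pref6]) fun J y => (l2Of_indicator_eq_bl2 i y (Gop i J)).symm.le
  · refine blockBd_of_census2140 i 1 1 hC'.le (h2140 1) (fun t => by simp [pref6]) fun J y => ?_
    rw [← l2Of_indicator_eq_bl2 i y]
    exact hfin (fun ν : Fin (d + 1) => l2Of _ ((DV ν i.cf ∘ₗ Gop i) J)) ν
  · refine blockBd_of_census2140 i 2 1 hC'.le (h2140 2) (fun t => by simp [pref6]) fun J y => ?_
    rw [← l2Of_indicator_eq_bl2 i y]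
    exact hfin (fun ν : Fin (d + 1) => l2Of _ ((Gop i ∘ₗ DVa ν i.cf) J)) ν
  · refine blockBd_of_census2140 i 3 0 hC'.le (h2140 3) (fun t => by simp [pref6]) fun J y => ?_
    rw [← l2Of_indicator_eq_bl2 i y]
    exact (hfin (fun μ : Fin (d + 1) => l2Of _ ((DV ν i.cf ∘ₗ Gop i ∘ₗ DVa μ i.cf) J)) μ).trans
      (hfin (fun ν : Fin (d + 1) => ⨆ μ : Fin (d + 1), l2Of _ ((DV ν i.cf ∘ₗ Gop i ∘ₗ DVa μ i.cf) J)) ν)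
  · refine blockBd_of_census2140 i 4 0 hC'.le (h2140 4) (fun t => by simp [pref6]) fun J y => ?_
    rw [← l2Of_indicator_eq_bl2 i y]
    exact (hfin (fun μ : Fin (d + 1) => l2Of _ ((DV ν i.cf ∘ₗ DV μ i.cf ∘ₗ Gop i) J)) μ).trans
      (hfin (fun ν : Fin (d + 1) => ⨆ μ : Fin (d + 1), l2Of _ ((DV ν i.cf ∘ₗ DV μ i.cf ∘ₗ Gop i) J)) ν)
  · refine blockBd_of_census2140 i 5 0 hC'.le (h2140 5) (fun t => by simp [pref6]) fun J y => ?_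
    rw [← l2Of_indicator_eq_bl2 i y]
    exact (hfin (fun μ : Fin (d + 1) => l2Of _ ((Gop i ∘ₗ DVa ν i.cf ∘ₗ DVa μ i.cf) J)) μ).trans
      (hfin (fun ν : Fin (d + 1) => ⨆ μ : Fin (d + 1), l2Of _ ((Gop i ∘ₗ DVa ν i.cf ∘ₗ DVa μ i.cf) J)) ν)

end Census

end Literature.MathematicalPhysics.QuantumFieldTheory.Balaban1983to89.B9Prop26L2AtPinsOne

end
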